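import Literature.MathematicalPhysics.QuantumFieldTheory.BalabanImbrieJaffe1984to88.BIJ88Sect3Rescaling
import Literature.MathematicalPhysics.QuantumFieldTheory.BalabanImbrieJaffe1984to88.BIJ88Sect3Normalization
import Literature.MathematicalPhysics.QuantumFieldTheory.Balaban1983to89.T4AxialGaugeFixing
import Literature.MathematicalPhysics.QuantumFieldTheory.Balaban1983to89.AveragingRT

/-!
# `BalabanImbrieJaffe1984to88.BIJ85RT33` — T. Bałaban, J. Imbrie, A. Jaffe, *Renormalization of the Higgs model:
minimizers, propagators and the stability of mean field theory*, Commun. Math. Phys. **97** (1985) 299–329 [BalabanImbrieJaffe1985],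
Sect. 3 p. 306: the renormalization transformation **(3.3)** `(𝒯e^{−S})(v, ψ) = ∫ e^{−S(u,φ)} δ_{Ax}(u) δ(v/Qu) δ_H(ψ − Qφ) 𝒟u𝒟φ`
with its constraint factors **(3.4)** `δ_{Ax}`, **(3.5)** `δ(v/Qu)`, **(3.6)** `δ_H`, TYPED AT MEASURE LEVEL on the torus carrier of record
(file 1/3 of seat p34 gen 2; file 2/3 `BIJ85RT37Normalization` PROVES the normalization property **(3.7)** `∫ 𝒯e^{−S} 𝒟v𝒟ψ = ∫ e^{−S} 𝒟u𝒟φ`,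
file 3/3 `BIJ88RT311` instantiates both to (3.11)–(3.13) of T. Bałaban, J. Imbrie, A. Jaffe, *Effective action and cluster properties of the
abelian Higgs model*, Commun. Math. Phys. **114** (1988) 257–315 [BalabanImbrieJaffe1988], p. 266: *"This is the renormalization
transformation, described in the previous paper. With the gauge fix δ_{Ax}(u), it takes the density ρ₀(u, φ) to ρ₁^L(v, ψ)"*).

statement-level skeleton of published theorems with citation tags; proofs where landed; nothing here is a claim about the Yang–Mills mass gap

PDF held: `paper:balaban1985-cmp97-bij-higgs-minimizers` (journal page = PDF page + 298); p. 306 [PDF 8] read on the render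
`run/sessions/literature-prover-lit-balaban-p34-g2-0/folder/pages/c1-p008a.png`, `c1-p008b.png` (poppler ×3); C2 p. 266–267 [PDF 10–11]
likewise (`pages/c2-p011a.png`, `HOME/lit-balaban-r18/renders/c2/c2-p010b.png`).

CITATION HEADER (lean-in-tree rule).  Part of the lit-balaban TYPED SKELETON (HOME `run/shared/lean/pub/lit-balaban/`), PHASE-2 proof seat p34
(gen 2, unit `lit-balaban-p34-g2`; TAKING line HOME/STATUS.md 2026-08-21T02:5xZ).  Rows served: `C1.Eq3.1-3.3` (the transformation 𝒯 of
(3.3) with (3.4)–(3.6), typed here; (3.1)–(3.2) `R = 𝒮_L𝒯` not typed), `C1.Eq3.7` ((3.7), PROVED in file 2/3) of `HOME/lit-balaban-r15/ROWS-C1.md`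
(owner r15); consumed by `C2.Eq3.11`/`C2.Eq3.13` (owner r18) in `BIJ88RT311`.

THE PRINTED TEXT (p. 306 [PDF 8], verbatim).  *"where 𝒯 is defined by (𝒯e^{−S})(v, ψ) = ∫ e^{−S(u,φ)} δ_{Ax}(u) δ(v/Qu) δ_H(ψ − Qφ) 𝒟u𝒟φ.
(3.3)  In (3.3) we specify the axial gauge with δ_{Ax}(u) which sets u_b = 1 on the set of bonds chosen as follows: Within each L-block B(y)
with corner y in the L-lattice, let T(y) denote the tree composed of unit bonds in Γ_{yx}. … Then δ_{Ax}(u) = Π_{y∈T_L} Π_{b∈T(y)} δ(u_b).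
(3.4) … The factor δ(v/Qu) is a delta function which specifies that the average gauge field in each block B(y) is v. Thus for b′ an
L-lattice bond, δ(v/Qu) = Π_{b′∈T_L} δ(v_{b′}/(Qu)_{b′}). (3.5)  The factor δ_H is an approximate delta function which specifies that the
block averages of the scalar (Higgs) field equal ψ. In particular, if y denotes an L-lattice site, δ_H(ψ − Qφ) = Π_{y∈T_L} [(a/2π)
exp(−(1/2)a|ψ − Q(u)φ|²)]. (3.6)  The integral (3.2) therefore has the normalization property ∫ 𝒯e^{−S} 𝒟v𝒟ψ = ∫ e^{−S} 𝒟u𝒟φ, (3.7)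
where 𝒟v𝒟ψ is a measure corresponding to (3.3) but on the L-lattice."*

CARRIER (of record for everything that INTEGRATES, ruling G.5-1/S2 of the cell): the unit lattice is the torus `Balaban1983to89.Site P j`
(`Setup`), the L-lattice is the next level `Site P (j+1)` (blocks `blockOf`); the gauge field `u` is `GaugeField P j U1`
(`U1 = Matrix.unitaryGroup (Fin 1) ℂ` of `BIJ88Sect3Statements`, read in `ℂ` through `toC`; C1's `Circle` through
`BIJ88Sect3Rescaling.circleEquivU1`), `𝒟u` = the product Haar PROBABILITY measure `fieldMeasure P j U1` (p. 274 of [BalabanImbrieJaffe1988]: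
*"∫du = 1"*), the scalar field `φ : HiggsField P j = Balaban1983to89.Site P j → ℂ` with Lebesgue measure `𝒟φ`; the block fields `v : GaugeField P (j+1) U1`,
`ψ : HiggsField P (j+1)` with `𝒟v` = `fieldMeasure P (j+1) U1`, `𝒟ψ` = Lebesgue — *"a measure corresponding to (3.3) but on the L-lattice"*.

HOW (3.3) IS TYPED (the δ-functions made honest; r18's plan for row C2.Eq3.11, ROWS-C2.md v1.7: *"ρ₁^L := Radon–Nikodym density of the
pushforward … cf. `AveragingRT.rnTransport`"*).
* **δ_{Ax}(u)𝒟u** (3.4) is the MEASURE `Π_{b∉T} du_b ⊗ Π_{b∈T} δ₁(u_b)` = the law of `U[T := 1]` (`T4AxialGaugeFixing.fixBonds T U`) under `dU`: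
  `∫ δ_{Ax}(u) G(u) 𝒟u := ∫ G(U[T := 1]) dU` (Haar is a probability measure, so integrating the frozen variables is harmless).  The bond set
  `T = ⋃_y T(y)` is DATA carrying a `T4AxialGaugeFixing.TreeOrder` (the peeling certificate under which the cell's measure-level axial gauge
  fixing `T4AxialGaugeFixing.integral_eq_integral_fixBonds` — the unit-Jacobian Faddeev–Popov identity `∫ F dU = ∫ F(U[T := 1]) dU` for
  gauge-invariant `F` — holds); the concrete trees `T(y)` of (3.4) are typed on the `ℤ^d` dictionary by seat p03 (`BIJ85AxialGauge34.IsTreeBond`,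
  `treeBonds`; spanning: `BIJ85AxialGauge35.card_treeBonds`, `BIJ85AxialGauge34.block_induction`) and are NOT re-built on the torus here.
* **Qu** (2.10) and **Q(u)φ** (2.6) are DATA: measurable maps `qU : GaugeField P j U1 → GaugeField P (j+1) U1`,
  `qH : GaugeField P j U1 → HiggsField P j → HiggsField P (j+1)` (p03's `BIJ85AxialGauge35.qU`, `qCov` on `ℤ^d` are the printed formulas);
  the one analytic property of (2.10) that (3.7) uses is recorded as the field `ac_qU`: the law of `Q(U[T := 1])` under `dU` is absolutely
  continuous w.r.t. `dV` (for the printed (2.10) this law IS `dV`: the substitution (3.9) `u_b ↦ u_b v_{b′}` on the surface bonds translates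
  `(Qu)_{b′}` by `v_{b′}` — (3.10)–(3.11), p03's `BIJ85Eq311Proof.eq311` — and preserves Haar measure, and a translation-invariant probability
  law on the compact group `U(1)^{T_L}` is Haar measure, `AveragingRT.measure_eq_mass_smul_of_invariant`; this discharge is NOT done here).
* **δ(v/Qu)** (3.5): `𝒯ρ` is, jointly in `(v, ψ)`, the Radon–Nikodym density w.r.t. `𝒟v𝒟ψ` of the push-forward along
  `(u, ψ) ↦ (Q(u[T := 1]), ψ)` of the complex measure `[∫𝒟φ ρ(u[T := 1], φ) δ_H(ψ − Q(u[T := 1])φ)] 𝒟u𝒟ψ` (real and imaginary parts,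
  positive and negative parts: four `Measure.rnDeriv`s) — `rt`.  For `ρ ≥ 0` and a test function `f(v, ψ)` this is the push-forward identity
  `∫ (𝒯ρ) f 𝒟v𝒟ψ = ∫ δ_{Ax}(u) ρ(u, φ) δ_H(ψ − Q(u)φ) f(Qu, ψ) 𝒟u𝒟φ𝒟ψ`, i.e. (3.3) read as in `Setup.IsRT`.
* **δ_H** (3.6) is an `ApproxDelta`: a non-negative jointly measurable kernel `K(c, ψ)` of total mass `∫ K(c, ψ)𝒟ψ = 1` for every centre `c`;
  the printed (3.6) is the instance `deltaH` (product over the L-lattice sites of the one-site factor `siteGauss` — pointwise p03's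
  `BIJ85AxialGauge35.gaussFactor` on the `ℤ^d` dictionary —, unit mass by r18's complex Gaussian
  `BIJ88Sect3Normalization.integral_exp_neg_mul_sq_norm_sub`); [BalabanImbrieJaffe1988] (3.11)–(3.12) is the other instance (file 2/2).
WHAT IS PROVED HERE.  `φ ↦ hφ` preserves `𝒟φ` (`measurePreserving_twist`: a product of rotations of the real inner product space `ℂ`), hence
the joint gauge invariance of a density `ρ(u, φ)` makes `u ↦ ∫𝒟φ ρ(u, φ)` and `u ↦ ∫⁻𝒟φ ‖ρ(u, φ)‖` gauge-invariant functions of the gauge field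
(`gaugeInvariant_integral`, `gaugeInvariant_lintegral` — the input of the axial Faddeev–Popov step of file 2/3); the unit mass of `δ_H` in
complex and `ℝ≥0∞` form; (3.6) IS an approximate δ-function (`deltaH`: measurable, `≥ 0`, unit mass by Fubini over the sites and the complex
Gaussian).  File 2/3 proves (3.7) `∫𝒟v ∫𝒟ψ (𝒯ρ)(v, ψ) = ∫𝒟u ∫𝒟φ ρ(u, φ)` for every jointly measurable, `𝒟u𝒟φ`-integrable, jointly
gauge-invariant `ρ`.
NOT DONE HERE (honest scope).  The concrete torus instances of T(y) (3.4), Qu (2.10), Q(u)φ (2.6) and the discharge of `ac_qU` for (2.10);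
(3.1)–(3.2) `R = 𝒮_L 𝒯` (the rescaling half); (3.8) and everything after.  Imports: Literature + Mathlib only; no `Prop`-valued facts are
introduced; standard axioms.
-/

namespace Literature.MathematicalPhysics.QuantumFieldTheory.BalabanImbrieJaffe1984to88.BIJ85RT33

open Literature.MathematicalPhysics.QuantumFieldTheory.Balaban1983to89
open BIJ88Sect3Statements (U1 toC toC_mul toC_one toC_inv norm_toC)
open BIJ85Sect1Model (HiggsField)
open BIJ88Sect3Rescaling (circleEquivU1 coe_circleEquivU1_symm)
open T4AxialGaugeFixing (TreeOrder fixBonds measurable_fixBonds)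
open GaugeField (gaugeAct GaugeInvariant)
open scoped BigOperators ENNReal
open _root_.MeasureTheory _root_.MeasureTheory.Measure Complex

noncomputable section
open Classical

variable {P : Params} {j : ℕ}

/-! ## §1 The gauge transformations (2.7) on the torus carrier: `φ ↦ hφ` preserves `𝒟φ`; joint gauge invariance -/

/-- kernel: `U(1) ∋ g ↦ toC g ∈ ℂ` (the matrix entry) is continuous. [cite: BalabanImbrieJaffe1985, (2.7) p.303] -/
theorem continuous_toC : Continuous (toC : U1 → ℂ) :=
  (continuous_subtype_val (p := fun M : Matrix (Fin 1) (Fin 1) ℂ => M ∈ Matrix.unitaryGroup (Fin 1) ℂ)).matrix_elem 0 0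

/-- kernel: `toC` is measurable. [cite: BalabanImbrieJaffe1985, (2.7) p.303] -/
theorem measurable_toC : Measurable (toC : U1 → ℂ) := continuous_toC.measurable

/-- **(2.7)** p. 303 [PDF 5], verbatim: *"let h denote a map from the unit lattice to U(1). Then h defines the gauge transformation
φ_y → h(y)φ_y ≡ φ^h_y"* — on the torus carrier, for `h : Balaban1983to89.Site P j → U(1)` (the gauge-field half `u_b → h(b₋)h(b₊)⁻¹u_b` is `Setup`'s
`GaugeField.gaugeAct`). [cite: BalabanImbrieJaffe1985, (2.7) p.303] -/
def twist (g : GaugeTransf P j U1) (φ : HiggsField P j) : HiggsField P j := fun x => toC (g x) * φ x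

/-- kernel: the value of `hφ` at a site. [cite: BalabanImbrieJaffe1985, (2.7) p.303] -/
@[simp] theorem twist_apply (g : GaugeTransf P j U1) (φ : HiggsField P j) (x : Balaban1983to89.Site P j) : twist g φ x = toC (g x) * φ x := rfl

/-- kernel: `φ ↦ hφ` is measurable. [cite: BalabanImbrieJaffe1985, (2.7) p.303] -/
theorem measurable_twist (g : GaugeTransf P j U1) : Measurable (twist g : HiggsField P j → HiggsField P j) :=
  measurable_pi_lambda _ fun x => (measurable_pi_apply x).const_mul _

/-- kernel: `φ ↦ hφ` PRESERVES the Lebesgue measure `𝒟φ` on `ℂ^{T₁}` — it is a product of rotations `z ↦ h(x)z`, `|h(x)| = 1`, of the real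
inner product space `ℂ` (Mathlib: `rotation`, `LinearIsometryEquiv.measurePreserving`, `volume_preserving_pi`).  This is what turns the joint
gauge invariance of a density into the gauge invariance of its `𝒟φ`-integral. [cite: BalabanImbrieJaffe1985, (2.7) p.303] -/
theorem measurePreserving_twist (g : GaugeTransf P j U1) :
    MeasurePreserving (twist g) (volume : Measure (HiggsField P j)) volume := by
  have h := volume_preserving_pi (fun x : Balaban1983to89.Site P j => (rotation (circleEquivU1.symm (g x))).measurePreserving)
  have hfun : (fun (a : HiggsField P j) (i : Balaban1983to89.Site P j) => (rotation (circleEquivU1.symm (g i))) (a i)) = twist g := by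
    funext φ x
    simp [twist, rotation_apply, coe_circleEquivU1_symm]
  rw [hfun] at h
  exact h

/-- JOINT GAUGE INVARIANCE of a function of `(u, φ)` under (2.7), `F(u^h, hφ) = F(u, φ)` for every `h : T₁ → U(1)` — p. 306:
*"They generate the gauge group of the integral 𝒯(exp −S)"*; [BalabanImbrieJaffe1988] p. 265: *"F is a gauge-invariant function"*.
[cite: BalabanImbrieJaffe1985, (2.7) p.303] -/
def JointInvariant {α : Type*} (F : GaugeField P j U1 → HiggsField P j → α) : Prop :=
  ∀ (g : GaugeTransf P j U1) (U : GaugeField P j U1) (φ : HiggsField P j), F (gaugeAct g U) (twist g φ) = F U φ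

/-- kernel: a section `φ ↦ ρ(u, φ)` of a jointly measurable density is measurable. [cite: BalabanImbrieJaffe1985, (3.3) p.306] -/
theorem measurable_section {α : Type*} [MeasurableSpace α] {ρ : GaugeField P j U1 → HiggsField P j → α}
    (hρm : Measurable (Function.uncurry ρ)) (U : GaugeField P j U1) : Measurable (ρ U) :=
  hρm.comp measurable_prodMk_left

/-- For a jointly gauge-invariant, jointly measurable density, `u ↦ ∫𝒟φ ρ(u, φ)` is a GAUGE-INVARIANT function of the gauge field
(change of variables `φ ↦ hφ`, `measurePreserving_twist`). [cite: BalabanImbrieJaffe1985, (3.7) p.306] -/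
theorem gaugeInvariant_integral {ρ : GaugeField P j U1 → HiggsField P j → ℂ} (hρm : Measurable (Function.uncurry ρ))
    (hρg : JointInvariant ρ) : GaugeInvariant (fun U => ∫ φ, ρ U φ) := by
  intro g U
  have hmp := measurePreserving_twist (P := P) (j := j) g
  calc ∫ φ, ρ (gaugeAct g U) φ = ∫ φ, ρ (gaugeAct g U) φ ∂(volume.map (twist g)) := by rw [hmp.map_eq]
    _ = ∫ φ, ρ (gaugeAct g U) (twist g φ) :=
        integral_map hmp.measurable.aemeasurable (measurable_section hρm _).aestronglyMeasurable
    _ = ∫ φ, ρ U φ := by simp_rw [hρg g U]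

/-- The same for the absolute value: `u ↦ ∫⁻𝒟φ ‖ρ(u, φ)‖` is gauge invariant. [cite: BalabanImbrieJaffe1985, (3.7) p.306] -/
theorem gaugeInvariant_lintegral {ρ : GaugeField P j U1 → HiggsField P j → ℂ} (hρm : Measurable (Function.uncurry ρ))
    (hρg : JointInvariant ρ) : GaugeInvariant (fun U => ∫⁻ φ, ‖ρ U φ‖ₑ) := by
  intro g U
  have hmp := measurePreserving_twist (P := P) (j := j) g
  calc ∫⁻ φ, ‖ρ (gaugeAct g U) φ‖ₑ = ∫⁻ φ, ‖ρ (gaugeAct g U) (twist g φ)‖ₑ :=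
        (hmp.lintegral_comp (measurable_section hρm _).enorm).symm
    _ = ∫⁻ φ, ‖ρ U φ‖ₑ := by simp_rw [hρg g U]

/-! ## §2 The data of (3.3)–(3.6): axial trees, block averages, the approximate δ-function -/

/-- THE BLOCK-AVERAGING DATA OF (3.3): the axial tree bonds `T = ⋃_{y∈T_L} T(y)` of **(3.4)** with a peeling certificate
(`T4AxialGaugeFixing.TreeOrder`), the nonlinear block average `Qu` of the gauge field **(2.10)** entering `δ(v/Qu)` **(3.5)**, the covariant
block average `Q(u)φ` of the scalar field **(2.6)** entering `δ_H(ψ − Qφ)` **(3.6)** — as measurable maps on the torus carrier — and the one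
property of (2.10) the normalization uses: the law of `Q(u[T := 1])` under `𝒟u` is absolutely continuous w.r.t. `𝒟v` (see the module
docstring: for the printed (2.10) it equals `𝒟v` by (3.9)–(3.11)). [cite: BalabanImbrieJaffe1985, (3.3) p.306] -/
structure RTData (P : Params) (j : ℕ) where
  /-- the bonds frozen by `δ_{Ax}` (3.4): `T = ⋃_y T(y)` -/
  tree : Finset (PBond P j)
  /-- fresh end of each tree bond (peeling certificate) -/
  fresh : PBond P j → Balaban1983to89.Site P j
  /-- rank of the sites (peeling certificate) -/
  rank : Balaban1983to89.Site P j → ℕ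
  /-- `T` is tree-like -/
  treeOrder : TreeOrder tree fresh rank
  /-- `Qu` (2.10): the block average of the gauge field -/
  qU : GaugeField P j U1 → GaugeField P (j + 1) U1
  /-- `Qu` is measurable -/
  measurable_qU : Measurable qU
  /-- `Q(u)φ` (2.6): the covariant block average of the scalar field -/
  qH : GaugeField P j U1 → HiggsField P j → HiggsField P (j + 1)
  /-- `Q(u)φ` is jointly measurable in `(u, φ)` -/
  measurable_qH : Measurable (Function.uncurry qH)
  /-- Haar regularity of the gauge average in the axial gauge: `law(Q(U[T := 1])) ≪ dV` -/
  ac_qU : (fieldMeasure P j U1).map (fun U => qU (fixBonds tree U)) ≪ fieldMeasure P (j + 1) U1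

/-- AN APPROXIMATE δ-FUNCTION `δ_H(ψ − c) = K(c, ψ)` (p. 306: *"The factor δ_H is an approximate delta function which specifies that the
block averages of the scalar (Higgs) field equal ψ"*): a non-negative jointly measurable kernel of unit mass in `ψ` for every centre `c` —
the property behind (3.7); (3.6) is the instance `deltaH`. [cite: BalabanImbrieJaffe1985, (3.6) p.306] -/
structure ApproxDelta (P : Params) (j : ℕ) where
  /-- `K(c, ψ) = δ_H(ψ − c)` -/
  K : HiggsField P (j + 1) → HiggsField P (j + 1) → ℝ
  /-- joint measurability in `(c, ψ)` -/
  measurable_K : Measurable (Function.uncurry K)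
  /-- `δ_H ≥ 0` -/
  K_nonneg : ∀ c ψ, 0 ≤ K c ψ
  /-- unit mass: `∫ δ_H(ψ − c) 𝒟ψ = 1` -/
  integral_K : ∀ c, ∫ ψ, K c ψ = 1

namespace ApproxDelta

variable (A : ApproxDelta P j)

/-- kernel: `δ_H(· − c)` is integrable (its integral is `1 ≠ 0`). [cite: BalabanImbrieJaffe1985, (3.6) p.306] -/
theorem integrable_K (c : HiggsField P (j + 1)) : Integrable (A.K c) :=
  Integrable.of_integral_ne_zero (by rw [A.integral_K c]; exact one_ne_zero)

/-- kernel: a section of the kernel is measurable. [cite: BalabanImbrieJaffe1985, (3.6) p.306] -/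
theorem measurable_K_left (c : HiggsField P (j + 1)) : Measurable (A.K c) := A.measurable_K.comp measurable_prodMk_left

/-- kernel: unit mass in the `ℝ≥0∞`-valued form, `∫⁻ δ_H(ψ − c) 𝒟ψ = 1`. [cite: BalabanImbrieJaffe1985, (3.6) p.306] -/
theorem lintegral_K (c : HiggsField P (j + 1)) : ∫⁻ ψ, ENNReal.ofReal (A.K c ψ) = 1 := by
  rw [← ofReal_integral_eq_lintegral_ofReal (A.integrable_K c) (Filter.Eventually.of_forall (A.K_nonneg c)), A.integral_K,
    ENNReal.ofReal_one]

/-- kernel: unit mass of the complexified kernel, `∫ (δ_H(ψ − c) : ℂ) 𝒟ψ = 1`. [cite: BalabanImbrieJaffe1985, (3.6) p.306] -/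
theorem integral_K_complex (c : HiggsField P (j + 1)) : ∫ ψ, (A.K c ψ : ℂ) = 1 := by
  rw [integral_complex_ofReal, A.integral_K, Complex.ofReal_one]

end ApproxDelta

/-- One factor of **(3.6)**: the normalised one-site Gaussian `(a/2π) exp(−(1/2)a|z − c|²)` on `ℂ` (pointwise the same function as p03's
`BIJ85AxialGauge35.gaussFactor a c z` on the `ℤ^d` dictionary). [cite: BalabanImbrieJaffe1985, (3.6) p.306] -/
def siteGauss (a : ℝ) (c z : ℂ) : ℝ := a / (2 * Real.pi) * Real.exp (-(a / 2) * ‖z - c‖ ^ 2)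

/-- kernel: the one-site factor is jointly continuous in `(c, z)`. [cite: BalabanImbrieJaffe1985, (3.6) p.306] -/
theorem continuous_siteGauss (a : ℝ) : Continuous (fun p : ℂ × ℂ => siteGauss a p.1 p.2) := by
  unfold siteGauss
  fun_prop

/-- kernel: the one-site factor has unit mass, `∫_ℂ (a/2π)e^{−½a|z − c|²} d²z = 1` for `a > 0` (the complex Gaussian
`∫_ℂ e^{−b|z − c|²}d²z = π/b` of r18's `BIJ88Sect3Normalization.integral_exp_neg_mul_sq_norm_sub`). [cite: BalabanImbrieJaffe1985, (3.6) p.306] -/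
theorem integral_siteGauss {a : ℝ} (ha : 0 < a) (c : ℂ) : ∫ z, siteGauss a c z = 1 := by
  unfold siteGauss
  rw [integral_const_mul, BIJ88Sect3Normalization.integral_exp_neg_mul_sq_norm_sub (a / 2) (half_pos ha) c]
  have hπ : Real.pi ≠ 0 := Real.pi_ne_zero
  field_simp

/-- **(3.6)** p. 306 [PDF 8], verbatim: *"δ_H(ψ − Qφ) = Π_{y∈T_L} [(a/2π) exp(−(1/2)a|ψ − Q(u)φ|²)]. (3.6)"* — on the torus carrier, as a
kernel in the centre `c = Q(u)φ`: the product over the L-lattice sites `y ∈ T_L = Balaban1983to89.Site P (j+1)` of the one-site factors `siteGauss`.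
[cite: BalabanImbrieJaffe1985, (3.6) p.306] -/
def deltaHKernel (a : ℝ) (c ψ : HiggsField P (j + 1)) : ℝ := ∏ y : Balaban1983to89.Site P (j + 1), siteGauss a (c y) (ψ y)

/-- kernel: the kernel (3.6) is jointly measurable in `(c, ψ)`. [cite: BalabanImbrieJaffe1985, (3.6) p.306] -/
theorem measurable_deltaHKernel (a : ℝ) : Measurable (Function.uncurry (deltaHKernel (P := P) (j := j) a)) := by
  have h : ∀ y : Balaban1983to89.Site P (j + 1),
      Measurable fun p : HiggsField P (j + 1) × HiggsField P (j + 1) => siteGauss a (p.1 y) (p.2 y) := fun y => by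
    have h1 : Measurable fun p : HiggsField P (j + 1) × HiggsField P (j + 1) => p.2 y - p.1 y :=
      ((measurable_pi_apply y).comp measurable_snd).sub ((measurable_pi_apply y).comp measurable_fst)
    unfold siteGauss
    exact measurable_const.mul (Real.measurable_exp.comp (measurable_const.mul (h1.norm.pow_const 2)))
  have hprod : Measurable fun p : HiggsField P (j + 1) × HiggsField P (j + 1) =>
      ∏ y : Balaban1983to89.Site P (j + 1), siteGauss a (p.1 y) (p.2 y) :=
    Finset.measurable_prod _ fun y _ => h y
  have e : Function.uncurry (deltaHKernel (P := P) (j := j) a) =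
      fun p => ∏ y : Balaban1983to89.Site P (j + 1), siteGauss a (p.1 y) (p.2 y) := by
    funext p
    rfl
  rw [e]
  exact hprod

/-- kernel: the kernel (3.6) is positive-valued for `a > 0` (*"approximate"* delta function: a strictly positive density; cf. p03's
`BIJ85AxialGauge35.deltaH_pos`). [cite: BalabanImbrieJaffe1985, (3.6) p.306] -/
theorem deltaHKernel_nonneg {a : ℝ} (ha : 0 < a) (c ψ : HiggsField P (j + 1)) : 0 ≤ deltaHKernel a c ψ :=
  Finset.prod_nonneg fun _ _ => mul_nonneg (div_nonneg ha.le (by positivity)) (Real.exp_pos _).le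

/-- kernel: the kernel (3.6) has unit mass in `ψ` for every centre (Fubini over the sites, `MeasureTheory.integral_fintype_prod_volume_eq_prod`,
and `integral_siteGauss`). [cite: BalabanImbrieJaffe1985, (3.6) p.306] -/
theorem integral_deltaHKernel {a : ℝ} (ha : 0 < a) (c : HiggsField P (j + 1)) : ∫ ψ, deltaHKernel a c ψ = 1 := by
  unfold deltaHKernel
  rw [integral_fintype_prod_volume_eq_prod (fun (y : Balaban1983to89.Site P (j + 1)) (z : ℂ) => siteGauss a (c y) z)]
  simp [integral_siteGauss ha]

/-- **(3.6) is an approximate δ-function**: for `a > 0` the kernel (3.6) is non-negative, jointly measurable and of unit mass in `ψ`.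
[cite: BalabanImbrieJaffe1985, (3.6) p.306] -/
def deltaH {a : ℝ} (ha : 0 < a) : ApproxDelta P j where
  K := deltaHKernel a
  measurable_K := measurable_deltaHKernel a
  K_nonneg := deltaHKernel_nonneg ha
  integral_K := integral_deltaHKernel ha

/-- kernel: the kernel of `deltaH` is (3.6). [cite: BalabanImbrieJaffe1985, (3.6) p.306] -/
@[simp] theorem deltaH_K {a : ℝ} (ha : 0 < a) : (deltaH (P := P) (j := j) ha).K = deltaHKernel a := rfl

/-! ## §3 (3.3): the renormalization transformation `𝒯` at measure level -/

/-- kernel: `∫ f = ∫ Re f + i ∫ Im f` for an integrable complex function (Mathlib's `integral_re_add_im` read on `ℂ`).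
[cite: BalabanImbrieJaffe1985, (3.3) p.306] -/
theorem integral_re_add_im_complex {X : Type*} [MeasurableSpace X] {μ : Measure X} {f : X → ℂ} (hf : Integrable f μ) :
    ((∫ x, (f x).re ∂μ : ℝ) : ℂ) + ((∫ x, (f x).im ∂μ : ℝ) : ℂ) * I = ∫ x, f x ∂μ := by
  have h := integral_re_add_im (𝕜 := ℂ) hf
  simp only [RCLike.re_to_complex, RCLike.im_to_complex, RCLike.I_to_complex] at h
  exact h

namespace RTData

variable (D : RTData P j) (A : ApproxDelta P j)

/-- `u[T := 1]`: the configuration on the support of `δ_{Ax}` (3.4) obtained by freezing the tree bonds (`T4AxialGaugeFixing.fixBonds`);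
`δ_{Ax}(u)𝒟u` is the law of `U[T := 1]` under `dU`. [cite: BalabanImbrieJaffe1985, (3.4) p.306] -/
def ax (U : GaugeField P j U1) : GaugeField P j U1 := fixBonds D.tree U

/-- kernel: `u ↦ u[T := 1]` is measurable. [cite: BalabanImbrieJaffe1985, (3.4) p.306] -/
theorem measurable_ax : Measurable D.ax := measurable_fixBonds D.tree

/-- kernel: `u ↦ Q(u[T := 1])` is measurable. [cite: BalabanImbrieJaffe1985, (3.5) p.306] -/
theorem measurable_qU_ax : Measurable fun U => D.qU (D.ax U) := D.measurable_qU.comp D.measurable_ax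

/-- kernel: the block-averaging map `(u, ψ) ↦ (Q(u[T := 1]), ψ)` along which (3.3) pushes forward. [cite: BalabanImbrieJaffe1985, (3.5) p.306] -/
def blockMap : GaugeField P j U1 × HiggsField P (j + 1) → GaugeField P (j + 1) U1 × HiggsField P (j + 1) :=
  Prod.map (fun U => D.qU (D.ax U)) id

/-- kernel: the block-averaging map is measurable. [cite: BalabanImbrieJaffe1985, (3.5) p.306] -/
theorem measurable_blockMap : Measurable D.blockMap := D.measurable_qU_ax.prodMap measurable_id

/-- The `δ_H`-SMEARED DENSITY `G(u, ψ) = ∫𝒟φ ρ(u, φ) δ_H(ψ − Q(u)φ)` (the `𝒟φ`-integral of (3.3) at fixed `u`, `ψ`).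
[cite: BalabanImbrieJaffe1985, (3.3) p.306] -/
def smear (ρ : GaugeField P j U1 → HiggsField P j → ℂ) (U : GaugeField P j U1) (ψ : HiggsField P (j + 1)) : ℂ :=
  ∫ φ, ρ U φ * (A.K (D.qH U φ) ψ : ℂ)

/-- The smeared density in the axial gauge, as a function on `(u, ψ)`-space: `(U, ψ) ↦ G(U[T := 1], ψ)`.
[cite: BalabanImbrieJaffe1985, (3.3) p.306] -/
def smearAx (ρ : GaugeField P j U1 → HiggsField P j → ℂ) (p : GaugeField P j U1 × HiggsField P (j + 1)) : ℂ :=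
  D.smear A ρ (D.ax p.1) p.2

/-- `𝒟u𝒟ψ`. [cite: BalabanImbrieJaffe1985, (3.3) p.306] -/
def fineMeasure (P : Params) (j : ℕ) : Measure (GaugeField P j U1 × HiggsField P (j + 1)) :=
  (fieldMeasure P j U1).prod volume

/-- `𝒟v𝒟ψ`, p. 306: *"a measure corresponding to (3.3) but on the L-lattice"*. [cite: BalabanImbrieJaffe1985, (3.7) p.306] -/
def blockMeasure (P : Params) (j : ℕ) : Measure (GaugeField P (j + 1) U1 × HiggsField P (j + 1)) :=
  (fieldMeasure P (j + 1) U1).prod volume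

/-- `𝒟u𝒟ψ` is s-finite (a probability measure times Lebesgue measure). [cite: BalabanImbrieJaffe1985, (3.3) p.306] -/
instance sFinite_fineMeasure : SFinite (fineMeasure P j) := by unfold fineMeasure; infer_instance

/-- `𝒟v𝒟ψ` is σ-finite. [cite: BalabanImbrieJaffe1985, (3.7) p.306] -/
instance sigmaFinite_blockMeasure : SigmaFinite (blockMeasure P j) := by unfold blockMeasure; infer_instance

/-- The PUSHED-FORWARD LAW on the block fields of a real weight `h(u, ψ) ≥ 0` (negative values cut off): the image under the block map of
`h(u, ψ) δ_{Ax}(u) 𝒟u𝒟ψ`. [cite: BalabanImbrieJaffe1985, (3.3) p.306] -/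
def pushLaw (h : GaugeField P j U1 × HiggsField P (j + 1) → ℝ) : Measure (GaugeField P (j + 1) U1 × HiggsField P (j + 1)) :=
  ((fineMeasure P j).withDensity fun p => ENNReal.ofReal (h p)).map D.blockMap

/-- The Radon–Nikodym density w.r.t. `𝒟v𝒟ψ` of the pushed-forward law of a REAL weight (difference of the positive and negative parts).
[cite: BalabanImbrieJaffe1985, (3.3) p.306] -/
def rnReal (h : GaugeField P j U1 × HiggsField P (j + 1) → ℝ) (q : GaugeField P (j + 1) U1 × HiggsField P (j + 1)) : ℝ :=
  ((D.pushLaw h).rnDeriv (blockMeasure P j) q).toReal - ((D.pushLaw fun p => -h p).rnDeriv (blockMeasure P j) q).toReal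

/-- **(3.3)** p. 306 [PDF 8], verbatim: *"(𝒯e^{−S})(v, ψ) = ∫ e^{−S(u,φ)} δ_{Ax}(u) δ(v/Qu) δ_H(ψ − Qφ) 𝒟u𝒟φ. (3.3)"* — for a complex
density `ρ(u, φ)` (here `e^{−S}`, in [BalabanImbrieJaffe1988] (3.11) `ρ₀ = F e^{−S}`): `(𝒯ρ)(v, ψ)` is the Radon–Nikodym density at `(v, ψ)`,
w.r.t. `𝒟v𝒟ψ`, of the push-forward along `(u, ψ) ↦ (Q(u[T := 1]), ψ)` of `[∫𝒟φ ρ(u[T := 1], φ) δ_H(ψ − Q(u[T := 1])φ)] 𝒟u𝒟ψ`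
(real/imaginary and positive/negative parts separately) — the δ-functions of (3.3)–(3.5) read as measures, see the module docstring.
[cite: BalabanImbrieJaffe1985, (3.3) p.306] -/
def rt (ρ : GaugeField P j U1 → HiggsField P j → ℂ) (V : GaugeField P (j + 1) U1) (ψ : HiggsField P (j + 1)) : ℂ :=
  (D.rnReal (fun p => (D.smearAx A ρ p).re) (V, ψ) : ℂ) + (D.rnReal (fun p => (D.smearAx A ρ p).im) (V, ψ) : ℂ) * I

end RTData

end

end Literature.MathematicalPhysics.QuantumFieldTheory.BalabanImbrieJaffe1984to88.BIJ85RT33
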